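import Mathlib
import HarnessLib
import Literature.MathematicalPhysics.QuantumLattice.SectorEigenvalueContinuation
import Literature.MathematicalPhysics.QuantumLattice.PairChirality
import Literature.MathematicalPhysics.QuantumLattice.FermionQuasiFree

/-!
# Route `EnslavedA1g`, support `PairChemicalPotentialWindow` (item `stmt-HubbardSuperconductivity-0939`) — lemmas

General-graph toolkit for the pair chemical-potential window of the Hubbard model
(`EnslavedA1gPairChemicalPotentialWindow.lean`), all folklore CAR / sector bookkeeping:

* polarization `2|Re⟨a,b⟩| ≤ ‖a‖² + ‖b‖²` (`two_mul_abs_re_dot_le`);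
* the grading `PairChirality.Shifts` moves Lieb's sectors `(N↑, N↓) = (a, b)`
  (`isInSector_mulVec_of_shifts`; Yang's `η†` has grade `(1,1)`, `shifts_etaRaise`), and
  `Σ_x ‖c_{xσ}ψ‖² = ⟨ψ, N_σ ψ⟩` (`sum_norm_annihilation_mulVec`);
* the commutator of the Hubbard Hamiltonian on a finite graph with one annihilator,
  `[H(t,U), c_{zτ}] = t Σ_{y ∼ z} c_{yτ} - U n_{zτ̄} c_{zτ}` (`hamiltonian_commutator_annihilation`;
  hopping part `hoppingSum_commutator_annihilation`, interaction part
  `interaction_commutator_annihilation`).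

Sources: E. H. Lieb, PRL 62 (1989) 1201 (sectors); H. Tasaki, *Physics and Mathematics of Quantum
Many-Body Systems* (2020) §9.3; F. H. L. Essler et al., *The One-Dimensional Hubbard Model*
(2005) §2.1–2.2 (CAR identities); Bratteli–Robinson II §5.2.1. No definition is introduced; the
sector/variational facts used downstream are the tree's (`HubbardSzSectorLadder`,
`HubbardRingPerronFrobeniusProofs`).
-/

noncomputable section

-- the mandated namespace `Summit.<Summit>.<Problem>.Theorems` repeats `HubbardSuperconductivity`
-- (single-problem summit, D-0017), which the `dupNamespace` linter flags on every declaration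
set_option linter.dupNamespace false

namespace Summit.HubbardSuperconductivity.HubbardSuperconductivity.Theorems.EnslavedA1g

open Matrix Finset
open Literature.Probability.LatticeModels Literature.MathematicalPhysics.QuantumLattice
open Literature.MathematicalPhysics.QuantumLattice.EigenvalueContinuation
  (re_star_dotProduct_self_nonneg re_star_dotProduct_self_pos)
open scoped ComplexOrder

/-! ### Linear algebra: polarization and the homogeneous variational principle -/

section LinAlg

variable {ι : Type*} [Fintype ι]

/-- Polarization bound `2 |Re ⟨a, b⟩| ≤ ‖a‖² + ‖b‖²`. [folklore] -/
theorem two_mul_abs_re_dot_le (a b : ι → ℂ) :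
    2 * |(star a ⬝ᵥ b).re| ≤ (star a ⬝ᵥ a).re + (star b ⬝ᵥ b).re := by
  have hba : (star b ⬝ᵥ a).re = (star a ⬝ᵥ b).re := by
    rw [star_dotProduct, Complex.star_def, Complex.conj_re]
  have h1 := re_star_dotProduct_self_nonneg (a - b)
  have h2 := re_star_dotProduct_self_nonneg (a + b)
  rw [star_sub, sub_dotProduct, dotProduct_sub, dotProduct_sub, Complex.sub_re, Complex.sub_re,
    Complex.sub_re, hba] at h1
  rw [star_add, add_dotProduct, dotProduct_add, dotProduct_add, Complex.add_re, Complex.add_re,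
    Complex.add_re, hba] at h2
  rcases abs_cases (star a ⬝ᵥ b).re with ⟨h, -⟩ | ⟨h, -⟩ <;> rw [h] <;> linarith

end LinAlg

/-! ### Sector bookkeeping: `(N↑, N↓) = (a, b)` -/

section Sectors

variable {Λ : Type*} [LinearOrder Λ] [Fintype Λ]

/-- A matrix of grade `(a, b)` (`PairChirality.Shifts`) maps the sector `(p, q)` into the sector
`(p + a, q + b)`. Tasaki (2020) §9.3. [folklore] -/
theorem isInSector_mulVec_of_shifts {a b : ℤ} {M : Matrix (Finset (Orb Λ)) (Finset (Orb Λ)) ℂ}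
    (hM : PairChirality.Shifts a b M) {p q p' q' : ℕ} (hp : (p' : ℤ) = p + a)
    (hq : (q' : ℤ) = q + b) {ψ : Fock (Orb Λ)} (hψ : IsInSector p q ψ) :
    IsInSector p' q' (M *ᵥ ψ) := by
  intro s hs
  rw [mulVec, dotProduct]
  refine Finset.sum_eq_zero fun t _ => ?_
  by_cases hMt : M s t = 0
  · rw [hMt, zero_mul]
  · have h := hM s t hMt
    by_cases ht : (upPart t).card = p ∧ (downPart t).card = q
    · exfalso
      apply hs
      omega
    · rw [hψ t ht, mul_zero]

/-- `c†_{x↑}` has grade `(1, 0)`. Tasaki (2020) §9.3. [folklore] -/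
theorem shifts_creation_up (x : Λ) :
    PairChirality.Shifts 1 0 (creation (orb x 0) : Matrix (Finset (Orb Λ)) (Finset (Orb Λ)) ℂ) := by
  have h := (PairChirality.shifts_annihilation_up (Λ := Λ) x).conjTranspose
  rwa [annihilation_conjTranspose] at h

/-- `c†_{x↓}` has grade `(0, 1)`. Tasaki (2020) §9.3. [folklore] -/
theorem shifts_creation_down (x : Λ) :
    PairChirality.Shifts 0 1 (creation (orb x 1) : Matrix (Finset (Orb Λ)) (Finset (Orb Λ)) ℂ) := by
  have h := (PairChirality.shifts_annihilation_down (Λ := Λ) x).conjTranspose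
  rwa [annihilation_conjTranspose] at h

/-- Yang's `η† = Σ_x ε_x c†_{x↑} c†_{x↓}` has grade `(1, 1)`: it adds one up and one down electron.
Yang, PRL 63 (1989) 2144. [folklore] -/
theorem shifts_etaRaise (ε : Λ → ℤˣ) :
    PairChirality.Shifts 1 1 (etaRaise ε : Matrix (Finset (Orb Λ)) (Finset (Orb Λ)) ℂ) := by
  unfold etaRaise
  refine PairChirality.Shifts.sum fun x _ => PairChirality.Shifts.smul ?_ _
  have h := (shifts_creation_up x).mul (shifts_creation_down x)
  simpa using h

/-- `Σ_x ‖c_{xσ} ψ‖² = ⟨ψ, (Σ_x n_{xσ}) ψ⟩`. [folklore] -/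
theorem sum_norm_annihilation_mulVec (σ : Fin 2) (ψ : Fock (Orb Λ)) :
    ∑ x : Λ, star (annihilation (orb x σ) *ᵥ ψ) ⬝ᵥ (annihilation (orb x σ) *ᵥ ψ) =
      star ψ ⬝ᵥ ((∑ x : Λ, numberOp x σ) *ᵥ ψ) := by
  rw [sum_mulVec, dotProduct_sum]
  refine Finset.sum_congr rfl fun x _ => ?_
  rw [← LiebThm1.star_dotProduct_conjTranspose_mul_mulVec, annihilation_conjTranspose]
  rfl

end Sectors

/-! ### The commutator `[H, c_{zτ}]` on a finite graph -/

section Commutator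

variable {Λ : Type*} [LinearOrder Λ] [Fintype Λ]

/-- `n_{xσ}` commutes with `c_j` for `j ≠ (x, σ)` (adjoint of `number_mul_creation_of_ne`).
Essler et al. (2005) §2.1, eq. (2.8). [folklore] -/
theorem numberOp_mul_annihilation_of_ne {x z : Λ} {σ τ : Fin 2} (h : orb x σ ≠ orb z τ) :
    numberOp x σ * annihilation (orb z τ) = annihilation (orb z τ) * numberOp x σ := by
  have h1 := congrArg conjTranspose (number_mul_creation_of_ne h)
  rw [conjTranspose_mul, conjTranspose_mul, conjTranspose_mul, conjTranspose_mul,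
    creation_conjTranspose, creation_conjTranspose, annihilation_conjTranspose] at h1
  rw [numberOp]
  exact h1.symm

/-- `n_{xσ} c_{xσ} = 0`. Essler et al. (2005) §2.1. [folklore] -/
theorem numberOp_mul_annihilation_self (x : Λ) (σ : Fin 2) :
    numberOp x σ * annihilation (orb x σ) = 0 := by
  rw [numberOp, Matrix.mul_assoc, LiebThm1.annihilation_mul_self, Matrix.mul_zero]

/-- `c_{xσ} n_{xσ} = c_{xσ}`. Essler et al. (2005) §2.1. [folklore] -/
theorem annihilation_mul_numberOp_self (x : Λ) (σ : Fin 2) :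
    annihilation (orb x σ) * numberOp x σ = annihilation (orb x σ) := by
  rw [numberOp, ← Matrix.mul_assoc, LiebThm1.annihilation_mul_creation_mul_annihilation]

/-- One site: `[n_{xτ'} n_{xτ}, c_{xτ}] = -n_{xτ'} c_{xτ}` for `τ' ≠ τ`. Essler et al. (2005) §2.1,
eqs. (2.8)–(2.11). [folklore] -/
theorem pairNumber_commutator_annihilation_same (x : Λ) {τ τ' : Fin 2} (hne : τ' ≠ τ) :
    numberOp x τ' * numberOp x τ * annihilation (orb x τ) -
        annihilation (orb x τ) * (numberOp x τ' * numberOp x τ) =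
      -(numberOp x τ' * annihilation (orb x τ)) := by
  have hc : numberOp x τ' * annihilation (orb x τ) = annihilation (orb x τ) * numberOp x τ' :=
    numberOp_mul_annihilation_of_ne fun h => hne (orb_eq_orb_iff.1 h).2
  rw [Matrix.mul_assoc, numberOp_mul_annihilation_self, Matrix.mul_zero, zero_sub,
    ← Matrix.mul_assoc, ← hc, Matrix.mul_assoc, annihilation_mul_numberOp_self]

/-- `n_{x↑} n_{x↓} = n_{xτ'} n_{xτ}` for `{τ, τ'} = {↑, ↓}` (number operators commute). [folklore] -/
theorem pairNumber_eq_of_ne (x : Λ) {τ τ' : Fin 2} (hne : τ' ≠ τ) :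
    numberOp x 0 * numberOp x 1 = numberOp x τ' * numberOp x τ := by
  have hcomm : numberOp x 0 * numberOp x 1 = numberOp x 1 * numberOp x 0 :=
    (numberAt_commute (orb x 0) (orb x 1)).eq
  fin_cases τ <;> fin_cases τ'
  · exact absurd rfl hne
  · exact hcomm
  · rfl
  · exact absurd rfl hne

/-- **Interaction commutator**: `[Σ_x n_{x↑} n_{x↓}, c_{zτ}] = -n_{zτ̄} c_{zτ}` (only the site `z`
contributes). Essler et al. (2005) §2.1. [folklore] -/
theorem interaction_commutator_annihilation (z : Λ) {τ τ' : Fin 2} (hne : τ' ≠ τ) :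
    (∑ x : Λ, numberOp x 0 * numberOp x 1) * annihilation (orb z τ) -
        annihilation (orb z τ) * ∑ x : Λ, numberOp x 0 * numberOp x 1 =
      -(numberOp z τ' * annihilation (orb z τ)) := by
  rw [Finset.sum_mul, Finset.mul_sum, ← Finset.sum_sub_distrib, Finset.sum_eq_single z]
  · rw [pairNumber_eq_of_ne z hne, pairNumber_commutator_annihilation_same z hne]
  · intro x _ hxz
    have h0 : numberOp x 0 * annihilation (orb z τ) = annihilation (orb z τ) * numberOp x 0 :=
      numberOp_mul_annihilation_of_ne fun h => hxz (orb_eq_orb_iff.1 h).1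
    have h1 : numberOp x 1 * annihilation (orb z τ) = annihilation (orb z τ) * numberOp x 1 :=
      numberOp_mul_annihilation_of_ne fun h => hxz (orb_eq_orb_iff.1 h).1
    rw [Matrix.mul_assoc, h1, ← Matrix.mul_assoc, h0, Matrix.mul_assoc, sub_self]
  · intro h
    exact absurd (Finset.mem_univ z) h

variable (G : SimpleGraph Λ) [DecidableRel G.Adj]

/-- **Hopping commutator**: `[Σ_{x∼y,σ} c†_{xσ} c_{yσ}, c_{zτ}] = -Σ_{y ∼ z} c_{yτ}`
(`[c†_i c_l, c_j] = -δ_{ij} c_l`). Bratteli–Robinson II §5.2.1. [folklore] -/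
theorem hoppingSum_commutator_annihilation (z : Λ) (τ : Fin 2) :
    (∑ x : Λ, ∑ y : Λ, ∑ σ : Fin 2,
          if G.Adj x y then creation (orb x σ) * annihilation (orb y σ) else
            (0 : Matrix (Finset (Orb Λ)) (Finset (Orb Λ)) ℂ)) * annihilation (orb z τ) -
      annihilation (orb z τ) * ∑ x : Λ, ∑ y : Λ, ∑ σ : Fin 2,
          (if G.Adj x y then creation (orb x σ) * annihilation (orb y σ) else 0) =
      -∑ y ∈ univ.filter (fun y => G.Adj z y), annihilation (orb y τ) := by
  have hterm : ∀ (x y : Λ) (σ : Fin 2),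
      (if G.Adj x y then creation (orb x σ) * annihilation (orb y σ) else
          (0 : Matrix (Finset (Orb Λ)) (Finset (Orb Λ)) ℂ)) * annihilation (orb z τ) -
        annihilation (orb z τ) *
          (if G.Adj x y then creation (orb x σ) * annihilation (orb y σ) else 0) =
      if x = z ∧ σ = τ then (if G.Adj x y then -annihilation (orb y σ) else 0) else 0 := by
    intro x y σ
    by_cases hxy : G.Adj x y
    · simp only [if_pos hxy]
      rw [creation_mul_annihilation_commutator_annihilation]
      by_cases h : x = z ∧ σ = τ
      · rw [if_pos h, if_pos (orb_eq_orb_iff.2 h)]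
      · rw [if_neg h, if_neg (mt orb_eq_orb_iff.1 h)]
    · simp only [if_neg hxy, zero_mul, mul_zero, sub_zero]
      split_ifs <;> rfl
  simp only [Finset.sum_mul, Finset.mul_sum, ← Finset.sum_sub_distrib, hterm]
  rw [Finset.sum_eq_single z]
  · simp only [true_and]
    rw [Finset.sum_filter, ← Finset.sum_neg_distrib]
    refine Finset.sum_congr rfl fun y _ => ?_
    rw [Finset.sum_ite_eq', if_pos (Finset.mem_univ _)]
    split_ifs <;> simp
  · intro x _ hxz
    simp [hxz]
  · intro h
    exact absurd (Finset.mem_univ z) h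

/-- **`[H(t,U), c_{zτ}] = t Σ_{y ∼ z} c_{yτ} - U n_{zτ̄} c_{zτ}`** for the Hubbard Hamiltonian on any
finite graph (the kinetic part moves the hole to the neighbours, the interaction counts the
opposite-spin occupation of `z`). Essler et al. (2005) §2.2; folklore. [folklore] -/
theorem hamiltonian_commutator_annihilation (t U : ℝ) (z : Λ) {τ τ' : Fin 2} (hne : τ' ≠ τ) :
    hamiltonian G t U * annihilation (orb z τ) - annihilation (orb z τ) * hamiltonian G t U =
      (t : ℂ) • (∑ y ∈ univ.filter (fun y => G.Adj z y), annihilation (orb y τ)) -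
        (U : ℂ) • (numberOp z τ' * annihilation (orb z τ)) := by
  have hT := sub_eq_iff_eq_add.1 (hoppingSum_commutator_annihilation G z τ)
  have hV := sub_eq_iff_eq_add.1 (interaction_commutator_annihilation z hne)
  unfold hamiltonian
  rw [add_mul, mul_add, smul_mul_assoc, smul_mul_assoc, mul_smul_comm, mul_smul_comm, hT, hV]
  simp only [smul_add, smul_neg, neg_smul, neg_neg]
  abel

end Commutator

end Summit.HubbardSuperconductivity.HubbardSuperconductivity.Theorems.EnslavedA1g
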